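import Literature.NumberTheory.LFunctions.WeilPositivityCertificate
import Summits.RiemannHypothesis.RiemannHypothesis.Theorems.WeilTwoPrimeDeflM78YDataUO0
import Summits.RiemannHypothesis.RiemannHypothesis.Theorems.WeilTwoPrimeDeflM78YDataUO1
import HarnessLib

/-!
# Deflated two-prime certificate M78Y: the dyadic PSD factor `U` of the odd block, rows 126–127

Data of the DEFLATED (rank-one augmented) two-prime certificate M78Y (`weilCertDeflM78Y`, Yoshida moment format `WeilCert`/`WeilCert23` [cite: Yoshida1992, §6, Thm 1 p. 310] with rank-one penalty forms (k_odd = 6; `WeilCert23.checkR1OK`, `WeilTwoPrimeCertificateDeflatedOK.lean`), half-length `a₀ = b = 39/50`, `N = 255`, `T = 120`, chain `weilTwoPrimeCellsT120` (multi-precision checked, `CellsOK₂₃`), odd Legendre blocks `C`, `D`, `Dn/Ls` of certificate H (same `nb = 128`), odd block only, complement level `β₂₃ = κ − κ' = 16/25`): generated by exact rational arithmetic mirroring the checker (GroundBarta rung-4 prover A, `cert/gen_defl2.py`, extension of the generator validated on certificate I). The penalty polynomials are rounded Rayleigh–Ritz vectors of the windowed Weil form at `c = 39/50`. Nothing about the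 data is trusted: only kernel-evaluated Booleans are consumed.
-/

noncomputable section

namespace Summit.RiemannHypothesis.RiemannHypothesis.Theorems.EvenWinsBeyondArch

open Literature.NumberTheory.LFunctions

set_option maxHeartbeats 4000000 in
/-- Row 126 of the dyadic PSD factor `U` (odd block, certificate M78Y). [folklore] -/
def weilCertDeflM78YUOR126 : List ℚ :=
  [
  0, 0, 0, 0,
  0, 0, 0, 0,
  0, 0, 0, 0,
  0, 0, 0, 0,
  0, 0, 0, 0,
  0, 0, 0, 0,
  0, 0, 0, 0,
  0, 0, 0, 0,
  0, 0, 0, 0,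
  0, 0, 0, 0,
  0, 0, 0, 0,
  0, 0, 0, 0,
  0, 0, 0, 0,
  0, 0, 0, 0,
  0, 0, 0, 0,
  0, 0, 0, 0,
  0, 0, 0, 0,
  0, 0, 0, 0,
  0, 0, 0, 0,
  0, 0, 0, 0,
  0, 0, 0, 0,
  0, 0, 0, 0,
  0, 0, 0, 0,
  0, 0, 0, 0,
  0, 0, 0, 0,
  0, 0, 0, 0,
  0, 0, 0, 0,
  0, 0, 0, 0,
  0, 0, 0, 0,
  0, 0, 0, 0,
  0, 0, 0, 0,
  0, 0, 6783155576472998925013/4722366482869645213696, 0]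

set_option maxHeartbeats 4000000 in
/-- Row 127 of the dyadic PSD factor `U` (odd block, certificate M78Y). [folklore] -/
def weilCertDeflM78YUOR127 : List ℚ :=
  [
  0, 0, 0, 0,
  0, 0, 0, 0,
  0, 0, 0, 0,
  0, 0, 0, 0,
  0, 0, 0, 0,
  0, 0, 0, 0,
  0, 0, 0, 0,
  0, 0, 0, 0,
  0, 0, 0, 0,
  0, 0, 0, 0,
  0, 0, 0, 0,
  0, 0, 0, 0,
  0, 0, 0, 0,
  0, 0, 0, 0,
  0, 0, 0, 0,
  0, 0, 0, 0,
  0, 0, 0, 0,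
  0, 0, 0, 0,
  0, 0, 0, 0,
  0, 0, 0, 0,
  0, 0, 0, 0,
  0, 0, 0, 0,
  0, 0, 0, 0,
  0, 0, 0, 0,
  0, 0, 0, 0,
  0, 0, 0, 0,
  0, 0, 0, 0,
  0, 0, 0, 0,
  0, 0, 0, 0,
  0, 0, 0, 0,
  0, 0, 0, 0,
  0, 0, 0, 6809861016669125293679/4722366482869645213696]


end Summit.RiemannHypothesis.RiemannHypothesis.Theorems.EvenWinsBeyondArch
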